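import Mathlib.NumberTheory.NumberField.Basic
import Mathlib.RingTheory.DedekindDomain.AdicValuation
import Mathlib.RingTheory.Valuation.ValuationRing
import Mathlib.RingTheory.Valuation.Integral
import Mathlib.RingTheory.DiscreteValuationRing.Basic
import HarnessLib

/-!
# The finite place of a number field defined by a discrete valuation ring

Let `K` be a number field and `𝒪'` a discrete valuation ring with fraction field `K` whose
maximal ideal contains a rational prime `ℓ`. Then `𝒪'` is the valuation ring of a finite place
`v` of `K` (a non-zero prime of `𝓞 K`): `𝒪' = (𝓞 K)_𝔭` with `𝔭 = 𝔪' ∩ 𝓞 K`. We prove the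
consequence used in Deligne–Serre 1974, 6.12 (where the discrete valuation ring `𝒪'` produced by
Lemme 6.11 has to be matched with "une place finie `λ` de `K`" of Thm. 6.1): there is
`v : HeightOneSpectrum (𝓞 K)` such that every element of `𝒪'` has `v`-adic valuation `≤ 1` and
every element of `𝔪'` has `v`-adic valuation `< 1`. Everything is PROVED (Mathlib:
`IsDedekindDomain.HeightOneSpectrum.valuationSubringAtPrime_eq_valuationSubring` and
`ValuationSubring.eq_of_le_of_ne_top`, a discrete valuation ring being a maximal proper
subring among valuation subrings).

* `Literature.NumberTheory.NumberFields.exists_heightOneSpectrum_valuation_le_of_dvr`.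

## References

* P. Deligne, J.-P. Serre, *Formes modulaires de poids 1*, Ann. Sci. ÉNS (4) 7 (1974), 6.12.
* J. Neukirch, *Algebraic Number Theory* (1999), Ch. I, (11.5); Ch. II, (3.8) (valuation rings
  and valuations).
-/

noncomputable section

open scoped NumberField

open IsLocalRing IsDedekindDomain

namespace Literature.NumberTheory.NumberFields

/-- **The place of a number field attached to a discrete valuation ring.** Let `K` be a number
field, `𝒪'` a discrete valuation ring with fraction field `K`, and `ℓ` a prime number lying in
the maximal ideal `𝔪'` of `𝒪'`. Then there is a finite place `v` of `K` (a non-zero prime of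
`𝓞 K`) whose valuation ring is `𝒪'`: every element of `𝒪'` has `v`-adic valuation `≤ 1`, and
every element of `𝔪'` has `v`-adic valuation `< 1`. Proof: `𝓞 K ⊆ 𝒪'` as `𝒪'` is integrally
closed, `𝔭 = 𝔪' ∩ 𝓞 K` is a non-zero prime (it contains `ℓ`), `(𝓞 K)_𝔭 ⊆ 𝒪'` are valuation
rings of `K`, and a discrete valuation ring is maximal among proper subrings (Mathlib
`ValuationSubring.eq_of_le_of_ne_top`), so `𝒪' = (𝓞 K)_𝔭` is the valuation ring of `v = 𝔭`
(cf. Neukirch, *Algebraic Number Theory*, Ch. I §11 and Ch. II §3: the discrete valuation rings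
of `K` containing `𝓞 K` are the localisations `(𝓞 K)_𝔭`). [folklore] -/
theorem exists_heightOneSpectrum_valuation_le_of_dvr (K : Type*) [Field K] [NumberField K]
    (𝒪' : Type*) [CommRing 𝒪'] [IsDomain 𝒪'] [IsDiscreteValuationRing 𝒪'] [Algebra 𝒪' K]
    [IsFractionRing 𝒪' K] {ℓ : ℕ} (hℓ : ℓ.Prime) (hℓm : (ℓ : 𝒪') ∈ maximalIdeal 𝒪') :
    ∃ v : HeightOneSpectrum (𝓞 K),
      (∀ s : 𝒪', v.valuation K (algebraMap 𝒪' K s) ≤ 1) ∧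
        ∀ s ∈ maximalIdeal 𝒪', v.valuation K (algebraMap 𝒪' K s) < 1 := by
  classical
  -- the valuation subring `W ⊆ K` defined by `𝒪'`
  let val := ValuationRing.valuation 𝒪' K
  let W : ValuationSubring K := val.valuationSubring
  have hW : ∀ x : K, x ∈ W ↔ ∃ s : 𝒪', algebraMap 𝒪' K s = x := fun x ↦ by
    rw [Valuation.mem_valuationSubring_iff, ← Valuation.mem_integer_iff]
    exact ValuationRing.mem_integer_iff 𝒪' K x
  have hinj : Function.Injective (algebraMap 𝒪' K) := IsFractionRing.injective 𝒪' K
  -- units of `W` come from units of `𝒪'`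
  have hunit : ∀ (s : 𝒪') (hs : algebraMap 𝒪' K s ∈ W), IsUnit (⟨algebraMap 𝒪' K s, hs⟩ : W) →
      IsUnit s := by
    intro s hs hsu
    obtain ⟨u, hu⟩ := hsu
    obtain ⟨t, ht⟩ := (hW _).mp ((u⁻¹ : Wˣ) : W).2
    have h1 : ((u : W) : K) * (((u⁻¹ : Wˣ) : W) : K) = 1 := by
      have := congrArg (fun w : W ↦ (w : K)) u.mul_inv
      rwa [MulMemClass.coe_mul, OneMemClass.coe_one] at this
    rw [hu, ← ht, ← map_mul] at h1
    change algebraMap 𝒪' K (s * t) = 1 at h1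
    rw [← map_one (algebraMap 𝒪' K)] at h1
    exact isUnit_iff_exists_inv.mpr ⟨t, hinj h1⟩
  -- `ℓ` is a non-unit of `W`, so `W ≠ ⊤`
  have hℓW : (ℓ : K) ∈ W := (hW _).mpr ⟨ℓ, by simp⟩
  have hℓW' : algebraMap 𝒪' K ℓ ∈ W := by simp [hℓW]
  have hℓnu : ¬ IsUnit (⟨(ℓ : K), hℓW⟩ : W) := by
    intro h
    have h' : IsUnit (⟨algebraMap 𝒪' K ℓ, hℓW'⟩ : W) := by
      have : (⟨algebraMap 𝒪' K ℓ, hℓW'⟩ : W) = ⟨(ℓ : K), hℓW⟩ := Subtype.ext (by simp)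
      rw [this]; exact h
    exact (IsLocalRing.mem_maximalIdeal _).mp hℓm (hunit _ _ h')
  have hℓ0 : (ℓ : K) ≠ 0 := Nat.cast_ne_zero.mpr hℓ.ne_zero
  have hWtop : W ≠ ⊤ := by
    intro h
    have hinv : (ℓ : K)⁻¹ ∈ W := h ▸ trivial
    refine hℓnu (isUnit_iff_exists_inv.mpr ⟨⟨_, hinv⟩, Subtype.ext ?_⟩)
    simp [mul_inv_cancel₀ hℓ0]
  -- `𝓞 K ⊆ W` (valuation rings are integrally closed)
  have hOW : ∀ z : 𝓞 K, (z : K) ∈ W := by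
    intro z
    have hz : IsIntegral W (z : K) := (show IsIntegral ℤ (z : K) from z.2).tower_top
    have := Valuation.Integers.mem_of_integral (Valuation.integer.integers val) hz
    rw [Valuation.mem_integer_iff] at this
    exact (Valuation.mem_valuationSubring_iff _ _).mpr this
  let θ : 𝓞 K →+* W := (algebraMap (𝓞 K) K).codRestrict W hOW
  have hθ : ∀ z : 𝓞 K, ((θ z : W) : K) = z := fun _ ↦ rfl
  -- the prime `𝔭 = 𝔪_W ∩ 𝓞 K`
  let 𝔭 : Ideal (𝓞 K) := (maximalIdeal W).comap θ
  haveI h𝔭 : 𝔭.IsPrime := Ideal.IsPrime.comap θ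
  have hθℓ : θ ℓ = ⟨(ℓ : K), hℓW⟩ := Subtype.ext (by rw [hθ]; simp)
  have hℓ𝔭 : (ℓ : 𝓞 K) ∈ 𝔭 := by
    change θ ℓ ∈ maximalIdeal W
    rw [IsLocalRing.mem_maximalIdeal, mem_nonunits_iff, hθℓ]
    exact hℓnu
  have h𝔭0 : 𝔭 ≠ ⊥ := fun h ↦ by
    have : (ℓ : 𝓞 K) = 0 := by simpa [h] using hℓ𝔭
    exact hℓ.ne_zero (by exact_mod_cast this)
  let v : HeightOneSpectrum (𝓞 K) := ⟨𝔭, h𝔭, h𝔭0⟩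
  -- `(𝓞 K)_𝔭 ≤ W`, hence `= W` (a DVR is maximal), and `W` is the valuation ring of `v`
  have hle : HeightOneSpectrum.valuationSubringAtPrime K v ≤ W := by
    rintro x ⟨a, s, hs, rfl⟩
    have hsu : IsUnit (θ s) := by
      by_contra h
      exact hs (show s ∈ 𝔭 from (IsLocalRing.mem_maximalIdeal _).mpr h)
    obtain ⟨u, hu⟩ := hsu
    have h1 : (((u⁻¹ : Wˣ) : W) : K) * ((s : 𝓞 K) : K) = 1 := by
      have := congrArg (fun w : W ↦ (w : K)) u.inv_mul
      rwa [MulMemClass.coe_mul, OneMemClass.coe_one, hu, hθ] at this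
    have hsinv : ((s : 𝓞 K) : K)⁻¹ ∈ W := by
      rw [← eq_inv_of_mul_eq_one_left h1]
      exact SetLike.coe_mem _
    exact W.mul_mem _ _ (hOW a) hsinv
  have hWeq : W = (v.valuation K).valuationSubring := by
    rw [← HeightOneSpectrum.valuationSubringAtPrime_eq_valuationSubring]
    exact (ValuationSubring.eq_of_le_of_ne_top _ hle hWtop).symm
  have hmemv : ∀ x : K, x ∈ W ↔ v.valuation K x ≤ 1 := fun x ↦ by
    rw [hWeq, Valuation.mem_valuationSubring_iff]
  refine ⟨v, fun s ↦ (hmemv _).mp ((hW _).mpr ⟨s, rfl⟩), fun s hs ↦ ?_⟩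
  have hsW : algebraMap 𝒪' K s ∈ W := (hW _).mpr ⟨s, rfl⟩
  refine lt_of_le_of_ne ((hmemv _).mp hsW) fun heq ↦ ?_
  -- valuation `= 1` would make `s` a unit of `W`, hence of `𝒪'`
  have hs0 : algebraMap 𝒪' K s ≠ 0 := fun h ↦ by
    rw [h, map_zero] at heq
    exact zero_ne_one heq
  have hinvW : (algebraMap 𝒪' K s)⁻¹ ∈ W := (hmemv _).mpr (by rw [map_inv₀, heq, inv_one])
  have hu : IsUnit (⟨algebraMap 𝒪' K s, hsW⟩ : W) :=
    isUnit_iff_exists_inv.mpr ⟨⟨_, hinvW⟩, Subtype.ext (mul_inv_cancel₀ hs0)⟩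
  exact (IsLocalRing.mem_maximalIdeal _).mp hs (hunit s hsW hu)

end Literature.NumberTheory.NumberFields
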